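import Summits.AtomisticToContinuum.Crystallization.Theorems.PalmUnimodularRigidityLayeredLawsSelectHcpAdjacentFrames
import Summits.AtomisticToContinuum.Crystallization.Theorems.PalmUnimodularRigidityLayeredLawsSelectHcpChartStarFrame
import Summits.AtomisticToContinuum.Crystallization.Theorems.PalmUnimodularRigidityLayeredLawsSelectHcpLocalChartIffBall
import Summits.AtomisticToContinuum.Crystallization.Theorems.PalmUnimodularRigidityLayeredLawsSelectHcpCorrMeanZeroPrelude

/-!
# Crux `LayeredLawsSelectHcp` (stmt-AtomisticToContinuum-9226), line `mtp-prestress-split-ergodic-frame`: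
# positions of the labels of the graph balls of radius `≤ 4` in the root frame (`tube_ballPositions`, G4)

Registered sub-goal `tube_ballPositions` (G4 of the far-field memo `Cruxes/LayeredLawsSelectHcp/LeadC3FarField.md`,
§8): DEAD RECKONING along label paths.  Let `X` be a rooted labelled chart of an every-point-good hcp-charted `S` and let
`(a, A)` fit its labelled star within `a/100` (`‖X v − a • A (Pᵢ v)‖ ≤ a/100`, `v ∈ hcpStarIdx`, `Pᵢ = hcpSite 1 √(2/3)`,
as produced by `tube_chartStarFrame`).  Then every label `u` of the graph ball `ballLabels n` has its atom pinned to the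
root frame, `‖X u − a • A (Pᵢ u)‖ ≤ cₙ · a`, with `c₂ = 758/10000`, `c₃ = 1974/10000`, `c₄ = 3747/10000`.

* `ball_frames` (frames along the ball, linear drift): every `w ∈ ballLabels n` carries a frame `(a_w, A_w)` fitting the
  star of the re-rooted chart `reRoot X w` (`tube_chartStarFrame` applied to the translated configuration,
  `tube_reRoot_isRootedChart`, `good_image_sub`) with `|a − a_w| ≤ n/50` and
  `‖a • A x − σ_w • (a_w • A_w x)‖ ≤ (5n/100) ‖x‖`, `σ_w = ±1` the parity sign of the layer of `w`: a new label of
  `ballLabels (n + 1)` is `labelShift v c` with `v ∈ ballLabels n` and `c` a star label, `reRoot X (labelShift v c)` is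
  `reRoot (reRoot X v) c` (`reRoot_reRoot`), so the landed `tube_adjacentFrames` compares the two frames up to the sign
  `σ_c`, and the signs multiply (`sign_labelShift`).
* `ball_positions_step`, `ball_positions` (positions, quadratic drift): for `u = labelShift w c ∈ ballLabels (n + 1)`,
  `X u = X w + reRoot X w c`, `Pᵢ u = Pᵢ w + σ_w Pᵢ c` (`hcpSite_labelShift`), and
  `X u − a A (Pᵢ u) = (X w − a A (Pᵢ w)) + (reRoot X w c − a_w A_w (Pᵢ c)) − σ_w (a A − σ_w a_w A_w)(Pᵢ c)`, whence
  `p_{n+1} = p_n + a/100 + n/5000 + 5n/100`, i.e. `‖X u − a A (Pᵢ u)‖ ≤ n a/100 + n(n−1) · 251/10000` on `ballLabels n`.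
* `tube_ballPositions`: the instances `n = 2, 3, 4` with `a ≥ 9/10`.

All `[folklore]`.
-/

noncomputable section

namespace Summit.AtomisticToContinuum.Crystallization.Theorems.PalmUnimodularRigidity.LayeredLawsSelectHcp

open MeasureTheory Set
open Literature.MathematicalPhysics.StatisticalMechanics Literature.Geometry.DiscreteGeometry
open Summit.AtomisticToContinuum.Crystallization.Theorems.LayeredLawsSelectHcp.Negative.DiracLaws (GoodShell)
open LocalChartIffBall

/-! ## Normed-space bookkeeping of the dead reckoning -/

/-- **Chaining two frame comparisons**: `‖p − s q‖ ≤ η`, `‖q − t r‖ ≤ θ` and `|s| = 1` give `‖p − (s t) r‖ ≤ η + θ`.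
[folklore] -/
theorem frame_chain {V : Type*} [NormedAddCommGroup V] [NormedSpace ℝ V] {s t η θ : ℝ} (hs : |s| = 1)
    {p q r : V} (h1 : ‖p - s • q‖ ≤ η) (h2 : ‖q - t • r‖ ≤ θ) : ‖p - (s * t) • r‖ ≤ η + θ := by
  have e : p - (s * t) • r = (p - s • q) + s • (q - t • r) := by rw [mul_smul, smul_sub]; abel
  rw [e]
  calc ‖(p - s • q) + s • (q - t • r)‖ ≤ ‖p - s • q‖ + ‖s • (q - t • r)‖ := norm_add_le _ _
    _ = ‖p - s • q‖ + ‖q - t • r‖ := by rw [norm_smul, Real.norm_eq_abs, hs, one_mul]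
    _ ≤ η + θ := add_le_add h1 h2

/-- **One step of the dead reckoning**: if the atom `xw` is within `p` of `a y`, the bond `xu − xw` within `δ` of
`a₁ z₁` (the frame at `w`), and the frame difference `‖a z − s a₁ z₁‖ ≤ η` (`s = ±1`), then `xu` is within
`p + δ + η` of `a (y + s z)`. [folklore] -/
theorem reckon_bound {V : Type*} [NormedAddCommGroup V] [NormedSpace ℝ V] {s : ℝ} (hs : s = 1 ∨ s = -1)
    {a a₁ p δ η : ℝ} {xu xw y z z₁ : V} (hw : ‖xw - a • y‖ ≤ p) (hb : ‖(xu - xw) - a₁ • z₁‖ ≤ δ)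
    (hF : ‖a • z - s • (a₁ • z₁)‖ ≤ η) : ‖xu - a • (y + s • z)‖ ≤ p + δ + η := by
  have e : xu - a • (y + s • z) = (xw - a • y) + ((xu - xw) - a₁ • z₁) - s • (a • z - s • (a₁ • z₁)) := by
    rcases hs with rfl | rfl <;> module
  have hs1 : ‖s • (a • z - s • (a₁ • z₁))‖ = ‖a • z - s • (a₁ • z₁)‖ := by
    rw [norm_smul]
    rcases hs with rfl | rfl <;> simp
  rw [e]
  calc ‖(xw - a • y) + ((xu - xw) - a₁ • z₁) - s • (a • z - s • (a₁ • z₁))‖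
      ≤ ‖(xw - a • y) + ((xu - xw) - a₁ • z₁)‖ + ‖s • (a • z - s • (a₁ • z₁))‖ := norm_sub_le _ _
    _ ≤ ‖xw - a • y‖ + ‖(xu - xw) - a₁ • z₁‖ + ‖a • z - s • (a₁ • z₁)‖ := by
        rw [hs1]; gcongr; exact norm_add_le _ _
    _ ≤ p + δ + η := by linarith

/-! ## Parity signs and the ideal sites under the label transport -/

/-- The parity sign of a layer is `±1`. [folklore] -/
theorem laySign_cases (v : ℤ × ℤ × ℤ) :
    (if Even v.1 then (1 : ℝ) else -1) = 1 ∨ (if Even v.1 then (1 : ℝ) else -1) = -1 := by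
  split_ifs <;> simp

/-- The parity sign of a layer has absolute value `1`. [folklore] -/
theorem abs_laySign (v : ℤ × ℤ × ℤ) : |(if Even v.1 then (1 : ℝ) else -1)| = 1 := by
  split_ifs <;> simp

/-- **The parity signs multiply under the label transport**: the layer of `labelShift v c = v ± c` has the parity of
`v.1 + c.1`. [folklore] -/
theorem sign_labelShift (v c : ℤ × ℤ × ℤ) :
    (if Even (labelShift v c).1 then (1 : ℝ) else -1) =
      (if Even v.1 then (1 : ℝ) else -1) * (if Even c.1 then (1 : ℝ) else -1) := by
  unfold labelShift
  by_cases hv : Even v.1 <;> by_cases hc : Even c.1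
  · rw [if_pos hv, if_pos hv, if_pos hc, Prod.fst_add, if_pos (hv.add hc), one_mul]
  · have h : ¬Even (v.1 + c.1) := fun h => hc ((Int.even_add.1 h).1 hv)
    rw [if_pos hv, if_pos hv, if_neg hc, Prod.fst_add, if_neg h, one_mul]
  · have h : ¬Even (v.1 - c.1) := fun h => hv ((Int.even_sub.1 h).2 hc)
    rw [if_neg hv, if_neg hv, if_pos hc, Prod.fst_sub, if_neg h, mul_one]
  · have h : Even (v.1 - c.1) := by
      rw [Int.even_sub]; exact ⟨fun h => absurd h hv, fun h => absurd h hc⟩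
    rw [if_neg hv, if_neg hv, if_neg hc, Prod.fst_sub, if_pos h]; norm_num

/-- **The ideal sites under the label transport**: `hcpSite (labelShift v c) = hcpSite v + σ_v • hcpSite c`, `σ_v` the
parity sign of the layer of `v` (`hcpSite_add_of_even`, `hcpSite_sub_of_odd`). [folklore] -/
theorem hcpSite_labelShift (a h : ℝ) (v c : ℤ × ℤ × ℤ) :
    hcpSite a h (labelShift v c) = hcpSite a h v + (if Even v.1 then (1 : ℝ) else -1) • hcpSite a h c := by
  unfold labelShift
  by_cases hv : Even v.1
  · rw [if_pos hv, if_pos hv, hcpSite_add_of_even a h hv, one_smul]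
  · rw [if_neg hv, if_neg hv, hcpSite_sub_of_odd a h (Int.not_even_iff_odd.1 hv), neg_smul, one_smul,
      sub_eq_add_neg]

/-- The label transporting to a labelled neighbour is a star label (`labelShift v` preserves the ideal distances and
touching is being a labelled neighbour). [folklore] -/
theorem mem_hcpStarIdx_of_labelShift_eq_nbr {v c ε : ℤ × ℤ × ℤ} (hε : ε ∈ hcpStarIdx)
    (h : labelShift v c = nbr v ε) : c ∈ hcpStarIdx := by
  rw [mem_hcpStarIdx_iff_dist, ← dist_hcpSite_labelShift 1 (Real.sqrt (2 / 3)) v 0 c, labelShift_zero, h]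
  exact (dist_ideal_eq_one_iff_nbr v _).2 ⟨ε, hε, rfl⟩

/-! ## Frames along the graph ball -/

/-- **Every label carries a frame**: the star of the chart re-rooted at any label `w` is fitted within `a_w/100` by some
frame `(a_w, A_w)`, `a_w ∈ [9/10, 1]` (`tube_chartStarFrame` for the translated configuration `S − X w`, which is
every-point-good and hcp-charted, `good_image_sub`, with the rooted chart `reRoot X w`, `tube_reRoot_isRootedChart`).
[folklore] -/
theorem exists_frame_reRoot {S : Set (EuclideanSpace ℝ (Fin 3))} (hgood : ∀ x ∈ S, GoodShell S x)
    (hch : HcpCharted S) {X : ℤ × ℤ × ℤ → EuclideanSpace ℝ (Fin 3)} (hX : IsRootedChart S X) (w : ℤ × ℤ × ℤ) :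
    ∃ a' : ℝ, 9 / 10 ≤ a' ∧ a' ≤ 1 ∧ ∃ A' : EuclideanSpace ℝ (Fin 3) ≃ₗᵢ[ℝ] EuclideanSpace ℝ (Fin 3),
      ∀ v ∈ hcpStarIdx, ‖reRoot X w v - a' • A' (hcpSite 1 (Real.sqrt (2 / 3)) v)‖ ≤ a' / 100 := by
  obtain ⟨-, hg', hch'⟩ := good_image_sub hgood hch (hX.2.1 w)
  exact tube_chartStarFrame _ hg' hch' _ (tube_reRoot_isRootedChart S X hX w)

/-- **Frames along the graph ball (linear drift).**  If `(a, A)` fits the labelled star of the rooted chart `X` within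
`a/100`, then every `w ∈ ballLabels n` carries a frame `(a_w, A_w)` fitting the star of `reRoot X w` within `a_w/100`
with `|a − a_w| ≤ n/50` and `‖a • A x − σ_w • (a_w • A_w x)‖ ≤ (5n/100) ‖x‖` for all `x`, `σ_w` the parity sign of the
layer of `w`: induction on `n`, one application of `tube_adjacentFrames` per step (to the chart re-rooted at a label of
`ballLabels n`, `reRoot_reRoot`), the signs multiplying by `sign_labelShift`. [folklore] -/
theorem ball_frames {S : Set (EuclideanSpace ℝ (Fin 3))} (hgood : ∀ x ∈ S, GoodShell S x) (hch : HcpCharted S)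
    {X : ℤ × ℤ × ℤ → EuclideanSpace ℝ (Fin 3)} (hX : IsRootedChart S X) {a : ℝ}
    {A : EuclideanSpace ℝ (Fin 3) ≃ₗᵢ[ℝ] EuclideanSpace ℝ (Fin 3)} (h9 : 9 / 10 ≤ a) (h1 : a ≤ 1)
    (hA : ∀ v ∈ hcpStarIdx, ‖X v - a • A (hcpSite 1 (Real.sqrt (2 / 3)) v)‖ ≤ a / 100) :
    ∀ n : ℕ, ∀ w ∈ ballLabels n, ∃ (a' : ℝ) (A' : EuclideanSpace ℝ (Fin 3) ≃ₗᵢ[ℝ] EuclideanSpace ℝ (Fin 3)),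
      9 / 10 ≤ a' ∧ a' ≤ 1 ∧
      (∀ v ∈ hcpStarIdx, ‖reRoot X w v - a' • A' (hcpSite 1 (Real.sqrt (2 / 3)) v)‖ ≤ a' / 100) ∧
      |a - a'| ≤ n / 50 ∧
      ∀ x : EuclideanSpace ℝ (Fin 3),
        ‖a • A x - (if Even w.1 then (1 : ℝ) else -1) • (a' • A' x)‖ ≤ 5 * n / 100 * ‖x‖ := by
  intro n
  induction n with
  | zero =>
    intro w hw
    rw [ballLabels_zero, Finset.mem_singleton] at hw
    subst hw
    refine ⟨a, A, h9, h1, ?_, by simp, fun x => ?_⟩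
    · rw [reRoot_zero X hX.1]; exact hA
    · simp
  | succ n ih =>
    intro w hw
    obtain ⟨v, hv, hvw⟩ := exists_of_mem_ballLabels_succ hw
    obtain ⟨a₁, A₁, h9₁, h1₁, hA₁, hd₁, hF₁⟩ := ih v hv
    rcases hvw with rfl | ⟨ε, hε, rfl⟩
    · refine ⟨a₁, A₁, h9₁, h1₁, hA₁, hd₁.trans ?_, fun x => (hF₁ x).trans ?_⟩
      · push_cast; linarith
      · push_cast; nlinarith [norm_nonneg x]
    · obtain ⟨c, hc⟩ := labelShift_surjective v (nbr v ε)
      have hcS : c ∈ hcpStarIdx := mem_hcpStarIdx_of_labelShift_eq_nbr hε hc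
      obtain ⟨-, hg', hch'⟩ := good_image_sub hgood hch (hX.2.1 v)
      have hXv := tube_reRoot_isRootedChart S X hX v
      obtain ⟨a₂, h9₂, h1₂, A₂, hA₂⟩ := exists_frame_reRoot hgood hch hX (nbr v ε)
      have hA₂' : ∀ u ∈ hcpStarIdx,
          ‖reRoot (reRoot X v) c u - a₂ • A₂ (hcpSite 1 (Real.sqrt (2 / 3)) u)‖ ≤ a₂ / 100 := by
        rw [reRoot_reRoot, hc]; exact hA₂
      obtain ⟨hd, hF⟩ :=
        tube_adjacentFrames _ hg' hch' _ hXv c hcS a₁ A₁ a₂ A₂ h9₁ h1₁ h9₂ h1₂ hA₁ hA₂'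
      refine ⟨a₂, A₂, h9₂, h1₂, hA₂, ?_, fun x => ?_⟩
      · calc |a - a₂| ≤ |a - a₁| + |a₁ - a₂| := abs_sub_le _ _ _
          _ ≤ n / 50 + 1 / 50 := add_le_add hd₁ hd
          _ = ((n + 1 : ℕ) : ℝ) / 50 := by push_cast; ring
      · rw [← hc, sign_labelShift]
        refine (frame_chain (abs_laySign v) (hF₁ x) (hF x)).trans (le_of_eq ?_)
        push_cast; ring

/-! ## Positions along the graph ball -/

/-- **One radius of dead reckoning.**  If `‖X w − a A (Pᵢ w)‖ ≤ p` on `ballLabels n`, then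
`‖X u − a A (Pᵢ u)‖ ≤ p + (a/100 + n/5000) + 5n/100` on `ballLabels (n + 1)`: a new label is `u = labelShift w c` with
`w ∈ ballLabels n` and `c` a star label, `X u − X w = reRoot X w c` is within `a_w/100` of `a_w A_w (Pᵢ c)` for the
frame at `w` (`ball_frames`: `a_w ≤ a + n/50`, frame difference `≤ 5n/100` on the unit vector `Pᵢ c`), and
`Pᵢ u = Pᵢ w + σ_w Pᵢ c` (`hcpSite_labelShift`, `reckon_bound`). [folklore] -/
theorem ball_positions_step {S : Set (EuclideanSpace ℝ (Fin 3))} (hgood : ∀ x ∈ S, GoodShell S x)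
    (hch : HcpCharted S) {X : ℤ × ℤ × ℤ → EuclideanSpace ℝ (Fin 3)} (hX : IsRootedChart S X) {a : ℝ}
    {A : EuclideanSpace ℝ (Fin 3) ≃ₗᵢ[ℝ] EuclideanSpace ℝ (Fin 3)} (h9 : 9 / 10 ≤ a) (h1 : a ≤ 1)
    (hA : ∀ v ∈ hcpStarIdx, ‖X v - a • A (hcpSite 1 (Real.sqrt (2 / 3)) v)‖ ≤ a / 100) (n : ℕ) {p : ℝ}
    (hp : ∀ w ∈ ballLabels n, ‖X w - a • A (hcpSite 1 (Real.sqrt (2 / 3)) w)‖ ≤ p) :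
    ∀ u ∈ ballLabels (n + 1),
      ‖X u - a • A (hcpSite 1 (Real.sqrt (2 / 3)) u)‖ ≤ p + (a / 100 + n / 5000) + 5 * n / 100 := by
  intro u hu
  obtain ⟨w, hw, hwu⟩ := exists_of_mem_ballLabels_succ hu
  have hn : (0 : ℝ) ≤ n := n.cast_nonneg
  rcases hwu with rfl | ⟨ε, hε, rfl⟩
  · have := hp w hw
    linarith
  · obtain ⟨a₁, A₁, -, -, hA₁, hd₁, hF₁⟩ := ball_frames hgood hch hX h9 h1 hA n w hw
    obtain ⟨c, hc⟩ := labelShift_surjective w (nbr w ε)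
    have hcS : c ∈ hcpStarIdx := mem_hcpStarIdx_of_labelShift_eq_nbr hε hc
    have hb : ‖(X (nbr w ε) - X w) - a₁ • A₁ (hcpSite 1 (Real.sqrt (2 / 3)) c)‖ ≤ a₁ / 100 := by
      have := hA₁ c hcS
      simp only [reRoot, hc] at this
      exact this
    have hP : hcpSite 1 (Real.sqrt (2 / 3)) (nbr w ε) =
        hcpSite 1 (Real.sqrt (2 / 3)) w + (if Even w.1 then (1 : ℝ) else -1) • hcpSite 1 (Real.sqrt (2 / 3)) c := by
      rw [← hc]; exact hcpSite_labelShift _ _ w c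
    have hFc : ‖a • A (hcpSite 1 (Real.sqrt (2 / 3)) c) -
        (if Even w.1 then (1 : ℝ) else -1) • (a₁ • A₁ (hcpSite 1 (Real.sqrt (2 / 3)) c))‖ ≤ 5 * n / 100 := by
      have := hF₁ (hcpSite 1 (Real.sqrt (2 / 3)) c)
      rwa [norm_ideal_strut hcS, mul_one] at this
    have ha₁ : a₁ ≤ a + n / 50 := by linarith [(abs_sub_le_iff.1 hd₁).2]
    rw [hP, LinearIsometryEquiv.map_add, LinearIsometryEquiv.map_smul]
    refine (reckon_bound (laySign_cases w) (hp w hw) hb hFc).trans ?_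
    linarith

/-- **Positions along the graph ball (quadratic drift).**  If `(a, A)` fits the labelled star of the rooted chart `X`
within `a/100`, then `‖X u − a • A (Pᵢ u)‖ ≤ n a/100 + n (n − 1) · 251/10000` for `u ∈ ballLabels n`
(`ball_positions_step` summed). [folklore] -/
theorem ball_positions {S : Set (EuclideanSpace ℝ (Fin 3))} (hgood : ∀ x ∈ S, GoodShell S x) (hch : HcpCharted S)
    {X : ℤ × ℤ × ℤ → EuclideanSpace ℝ (Fin 3)} (hX : IsRootedChart S X) {a : ℝ}
    {A : EuclideanSpace ℝ (Fin 3) ≃ₗᵢ[ℝ] EuclideanSpace ℝ (Fin 3)} (h9 : 9 / 10 ≤ a) (h1 : a ≤ 1)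
    (hA : ∀ v ∈ hcpStarIdx, ‖X v - a • A (hcpSite 1 (Real.sqrt (2 / 3)) v)‖ ≤ a / 100) (n : ℕ) :
    ∀ u ∈ ballLabels n,
      ‖X u - a • A (hcpSite 1 (Real.sqrt (2 / 3)) u)‖ ≤ n * a / 100 + n * ((n : ℝ) - 1) * 251 / 10000 := by
  induction n with
  | zero =>
    intro u hu
    rw [ballLabels_zero, Finset.mem_singleton] at hu
    subst hu
    rw [hX.1, hcpSite_zero, LinearIsometryEquiv.map_zero, smul_zero, sub_zero, norm_zero]
    simp
  | succ n ih =>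
    intro u hu
    refine (ball_positions_step hgood hch hX h9 h1 hA n ih u hu).trans (le_of_eq ?_)
    push_cast; ring

/-- **Positions along the graph ball, with a constant**: `‖X u − a • A (Pᵢ u)‖ ≤ C a` on `ballLabels n` as soon as
`n a/100 + n (n − 1) · 251/10000 ≤ C a` (`ball_positions`; stated for a general radius `n`, so that no closed ball
`ballLabels 3`, `ballLabels 4` is ever unfolded by the elaborator). [folklore] -/
theorem ball_positions_le {S : Set (EuclideanSpace ℝ (Fin 3))} (hgood : ∀ x ∈ S, GoodShell S x)
    (hch : HcpCharted S) {X : ℤ × ℤ × ℤ → EuclideanSpace ℝ (Fin 3)} (hX : IsRootedChart S X) {a : ℝ}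
    {A : EuclideanSpace ℝ (Fin 3) ≃ₗᵢ[ℝ] EuclideanSpace ℝ (Fin 3)} (h9 : 9 / 10 ≤ a) (h1 : a ≤ 1)
    (hA : ∀ v ∈ hcpStarIdx, ‖X v - a • A (hcpSite 1 (Real.sqrt (2 / 3)) v)‖ ≤ a / 100) (n : ℕ) {C : ℝ}
    (hC : n * a / 100 + n * ((n : ℝ) - 1) * 251 / 10000 ≤ C * a) :
    ∀ u ∈ ballLabels n, ‖X u - a • A (hcpSite 1 (Real.sqrt (2 / 3)) u)‖ ≤ C * a :=
  fun u hu => (ball_positions hgood hch hX h9 h1 hA n u hu).trans hC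

/-! ## The registered stub -/

/-- **Registered sub-goal `tube_ballPositions` (G4): the labels of the graph balls of radius `2, 3, 4` are pinned to the
root frame.**  For every-point-good hcp-charted `S`, a rooted labelled chart `X` of `S` and a frame `(a, A)`,
`a ∈ [9/10, 1]`, fitting the labelled star of `X` within `a/100`, every `u ∈ ballLabels n` has
`‖X u − a • A (Pᵢ u)‖ ≤ cₙ a` with `c₂ = 758/10000`, `c₃ = 1974/10000`, `c₄ = 3747/10000` (`Pᵢ = hcpSite 1 √(2/3)`): dead
reckoning along label paths (`ball_positions`: `n a/100 + n(n−1) · 251/10000`, from the frames along the ball,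
`ball_frames`, i.e. `tube_chartStarFrame` at every label and `tube_adjacentFrames` between adjacent ones), and
`a ≥ 9/10`. [folklore] -/
theorem tube_ballPositions : ∀ (S : Set (EuclideanSpace ℝ (Fin 3))), (∀ x ∈ S, GoodShell S x) → HcpCharted S → ∀ X : ℤ × ℤ × ℤ → EuclideanSpace ℝ (Fin 3), IsRootedChart S X → ∀ (a : ℝ) (A : EuclideanSpace ℝ (Fin 3) ≃ₗᵢ[ℝ] EuclideanSpace ℝ (Fin 3)), 9 / 10 ≤ a → a ≤ 1 → (∀ v ∈ hcpStarIdx, ‖X v - a • A (hcpSite 1 (Real.sqrt (2 / 3)) v)‖ ≤ a / 100) → (∀ u ∈ ballLabels 2, ‖X u - a • A (hcpSite 1 (Real.sqrt (2 / 3)) u)‖ ≤ 758 / 10000 * a) ∧ (∀ u ∈ ballLabels 3, ‖X u - a • A (hcpSite 1 (Real.sqrt (2 / 3)) u)‖ ≤ 1974 / 10000 * a) ∧ (∀ u ∈ ballLabels 4, ‖X u - a • A (hcpSite 1 (Real.sqrt (2 / 3)) u)‖ ≤ 3747 / 10000 * a) := by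
  intro S hgood hch X hX a A h9 h1 hA
  exact ⟨ball_positions_le hgood hch hX h9 h1 hA 2 (C := 758 / 10000) (by push_cast; linarith),
    ball_positions_le hgood hch hX h9 h1 hA 3 (C := 1974 / 10000) (by push_cast; linarith),
    ball_positions_le hgood hch hX h9 h1 hA 4 (C := 3747 / 10000) (by push_cast; linarith)⟩

end Summit.AtomisticToContinuum.Crystallization.Theorems.PalmUnimodularRigidity.LayeredLawsSelectHcp

end
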